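import Summits.ResolutionOfSingularities.ResolutionOfSingularities.Theorems.Steer.Negative.ConsequentLoadBearing
import Summits.ResolutionOfSingularities.ResolutionOfSingularities.Theorems.WildConesIsolatedForcedTermination

/-!
# Crux `Steer` (stmt-ResolutionOfSingularities-16345) after its antecedent landed: `Steer` IS torsor LU over perfect fields

Route `ResolutionOfSingularities/FrobeniusClosing`, crux #3 (shared verbatim with `WildCones`,
`JacobianBudget`, `EscapeRate`): `Steer := IsolatedForcedTermination → TorsorLUPerfect` (the consequent
is verbatim the route's support item `TorsorLUPerfect`, stmt-ResolutionOfSingularities-16158, itself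
verbatim `ShadowGame.TorsorLUPerfect`).

The antecedent `IsolatedForcedTermination` (stmt-ResolutionOfSingularities-16343) is now a THEOREM of
the tree (`Theorems.WildCones.IsolatedForcedTermination_proof`, `Theorems/WildConesIsolatedForcedTermination.lean`).
Negative-side consequences recorded here (refuter seat res-L0-w41-tri-1, chain w41, 2026-08-26),
everything kernel-checked, no definition introduced:

* `steer_iff_torsorLUPerfect` — UNCONDITIONALLY `Steer ↔ TorsorLUPerfect`: the antecedent carries no
  logical strength any more; items stmt-16345 and stmt-16158 are one problem (local uniformization of
  `α_p`-torsors `t ^ p = a` over PERFECT ground fields along every valuation, base regular at the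
  centre). `Cruxes/Steer/Disproof.lean` §5 had this modulo the target (`steer_iff_torsorLUPerfect_of_ift`).
* `not_steer_iff_not_torsorLUPerfect` — what a refutation of the crux must now be: exactly a
  counterexample to torsor LU over a perfect field (which would refute the summit,
  `Cruxes/Steer/Disproof.lean` §1 `not_resolutionOfSingularities_of_not_steer`). No cheap kill exists.
* `not_steerWithoutFrac`, `not_steerWithoutFG`, `not_steerWithoutTorsor` — the three crux-level
  mutations of `ConsequentLoadBearing.lean` (delete `IsFractionRing (A₀[t]) K` / `A₀.FG` / `t ^ p ∈ A₀`
  from the consequent, antecedent kept), shown there to be EQUIVALENT to `¬ IsolatedForcedTermination`,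
  are now FALSE outright: every proof of `Steer` must use each of the three bookkeeping hypotheses.

Moral for the next door: the open content of `Steer` is `TorsorLUPerfect` and nothing else; by
`Theorems.SwitchingDichotomy.steer_iff_steerDefectCore4_of_cossartPiltant2019LU3` it is, modulo
Cossart–Piltant LU in dimension `≤ 3`, the dimension-`≥ 4` immediate-defect core
(`Literature.Barriers.ResolutionOfSingularities.DimensionFourFrontier`). Does NOT refute the crux.
Everything here is OURS (campaign res-hironaka, rung L, slot W4.1); NOT a statement of Hironaka's manuscript.
-/

set_option linter.dupNamespace false

open Summit.ResolutionOfSingularities.ResolutionOfSingularities.Theses.FrobeniusClosing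
  (Steer IsolatedForcedTermination TorsorLUPerfect)
open Summit.ResolutionOfSingularities.ResolutionOfSingularities.Theorems.WildCones
  (IsolatedForcedTermination_proof)

namespace Summit.ResolutionOfSingularities.ResolutionOfSingularities.Theorems.Steer.Negative

/-! ### The antecedent is discharged -/

/-- **`Steer ↔ TorsorLUPerfect`, unconditionally** (the antecedent `IsolatedForcedTermination` is the
theorem `Theorems.WildCones.IsolatedForcedTermination_proof`): crux stmt-16345 and support item
stmt-16158 are the same proposition up to a proved hypothesis. [folklore] -/
theorem steer_iff_torsorLUPerfect : Steer ↔ TorsorLUPerfect :=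
  ⟨fun h => h IsolatedForcedTermination_proof, fun h _ => h⟩

/-- **What a refutation of `Steer` must now be**: exactly a counterexample to local uniformization of
`α_p`-torsors over a perfect ground field. [folklore] -/
theorem not_steer_iff_not_torsorLUPerfect : ¬ Steer ↔ ¬ TorsorLUPerfect :=
  not_congr steer_iff_torsorLUPerfect

/-! ### The three bookkeeping mutations are false outright -/

/-- **`Steer` with `IsFractionRing (A₀[t]) K` deleted from the consequent (antecedent kept) is FALSE.**
(`steerWithoutFrac_iff_not_isolatedForcedTermination` + the landed target.) [folklore] -/
theorem not_steerWithoutFrac :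
    ¬ (IsolatedForcedTermination → ∀ p : ℕ, p.Prime →
      ∀ (k K : Type) [Field k] [CharP k p] [PerfectField k] [Field K] [Algebra k K]
      (O : ValuationSubring K) (A₀ : Subalgebra k K) (h₀ : A₀.toSubring ≤ O.toSubring) (t : K),
      A₀.FG → t ^ p ∈ A₀ →
      IsRegularLocalRing (Localization.AtPrime (Ideal.comap (Subring.inclusion h₀)
        (IsLocalRing.maximalIdeal O))) →
      ∃ (A : Subalgebra k K) (h : A.toSubring ≤ O.toSubring), A₀ ≤ A ∧ t ∈ A ∧ A.FG ∧
        IsFractionRing A K ∧ IsRegularLocalRing (Localization.AtPrime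
          (Ideal.comap (Subring.inclusion h) (IsLocalRing.maximalIdeal O)))) :=
  fun H => steerWithoutFrac_iff_not_isolatedForcedTermination.mp H IsolatedForcedTermination_proof

/-- **`Steer` with `A₀.FG` deleted from the consequent (antecedent kept) is FALSE.** [folklore] -/
theorem not_steerWithoutFG :
    ¬ (IsolatedForcedTermination → ∀ p : ℕ, p.Prime →
      ∀ (k K : Type) [Field k] [CharP k p] [PerfectField k] [Field K] [Algebra k K]
      (O : ValuationSubring K) (A₀ : Subalgebra k K) (h₀ : A₀.toSubring ≤ O.toSubring) (t : K),
      t ^ p ∈ A₀ → IsFractionRing (Algebra.adjoin k (insert t (A₀ : Set K))) K →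
      IsRegularLocalRing (Localization.AtPrime (Ideal.comap (Subring.inclusion h₀)
        (IsLocalRing.maximalIdeal O))) →
      ∃ (A : Subalgebra k K) (h : A.toSubring ≤ O.toSubring), A₀ ≤ A ∧ t ∈ A ∧ A.FG ∧
        IsFractionRing A K ∧ IsRegularLocalRing (Localization.AtPrime
          (Ideal.comap (Subring.inclusion h) (IsLocalRing.maximalIdeal O)))) :=
  fun H => steerWithoutFG_iff_not_isolatedForcedTermination.mp H IsolatedForcedTermination_proof

/-- **`Steer` with `t ^ p ∈ A₀` deleted from the consequent (antecedent kept) is FALSE.** [folklore] -/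
theorem not_steerWithoutTorsor :
    ¬ (IsolatedForcedTermination → ∀ p : ℕ, p.Prime →
      ∀ (k K : Type) [Field k] [CharP k p] [PerfectField k] [Field K] [Algebra k K]
      (O : ValuationSubring K) (A₀ : Subalgebra k K) (h₀ : A₀.toSubring ≤ O.toSubring) (t : K),
      A₀.FG → IsFractionRing (Algebra.adjoin k (insert t (A₀ : Set K))) K →
      IsRegularLocalRing (Localization.AtPrime (Ideal.comap (Subring.inclusion h₀)
        (IsLocalRing.maximalIdeal O))) →
      ∃ (A : Subalgebra k K) (h : A.toSubring ≤ O.toSubring), A₀ ≤ A ∧ t ∈ A ∧ A.FG ∧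
        IsFractionRing A K ∧ IsRegularLocalRing (Localization.AtPrime
          (Ideal.comap (Subring.inclusion h) (IsLocalRing.maximalIdeal O)))) :=
  fun H => steerWithoutTorsor_iff_not_isolatedForcedTermination.mp H IsolatedForcedTermination_proof

end Summit.ResolutionOfSingularities.ResolutionOfSingularities.Theorems.Steer.Negative
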